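import Summits.AtomisticToContinuum.BoseEinsteinCondensation.Theses.BECRichardsonGaudin
import Summits.AtomisticToContinuum.BoseEinsteinCondensation.Theorems.BECGroundStateSOSPeriodicIRBoundFsumCouplingSelect
import HarnessLib

/-!
# Birth skeleton — crux `RichardsonAnchorBEC` (stmt-AtomisticToContinuum-14805), route `BECRichardsonGaudin`

`Lines/birth.lean` of the crux (BC3 of the Lean birth certificate; registrar unit
`skel-stmt-AtomisticToContinuum-14805`). The crux, BY NAME:
`Summit.AtomisticToContinuum.BoseEinsteinCondensation.Theses.BECRichardsonGaudin.RichardsonAnchorBEC`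
— complete condensation, in the dilute limit, of the near-minimisers of the Richardson anchor
functional `E_Δ(Φ) = ∫|∇Φ|² + Δ(N - n₀(Φ)) + (γ/L⁹)(N(N-1)/2)∫|∫∫ conj(w_M) Φ|²`, `Δ = 2ργ`, on the
torus `L = (N/ρ)^{1/3}`: `∀ γ ≥ 0, Λ > 0, ε > 0 ∃ ρ₀ ∀ ρ < ρ₀ ∀ᶠ N ∃ δ > 0`, every `δ`-near-minimiser
has `n₀ ≥ (1-ε)N`.

## The line: condensate penalty (number-conserving source) ⇒ variational inequality

It is the route's own two-layer plan for this node (`AnchorEnergyWithSource → AnchorSourceResponse`,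
no gauge breaking anywhere), cut so that BOTH halves are genuine and neither is the crux. The
source-response inequality `SR : inf_Φ [E_Δ(Φ) + λ n₀(Φ)] ≥ inf E_Δ + λ(1-ε)N` gives the crux by
the Griffiths/Hellmann–Feynman variational inequality at fixed `N` (`λ n₀(Ψ) ≥ SR - E_Δ(Ψ)`), but
`SR` alone is essentially the crux again (costume), so it is NOT a stub: it is split through an
EXPLICIT reference energy, the Born-renormalised Hartree energy
`e_ref = bornEnergy = γρN / (2(1 + γ J_M))`, `J_M = (1/(2L³)) ∑_{m ∈ B_M∖0} 1/k_m²` (`bandBubble`,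
the zero-energy pair bubble of the band; `γ/(1+γJ_M)` is the band-limited zero-momentum pair
`T`-matrix — checked on the exact two-body problem of `(γ/2V)P†P`: `E₂ = (γ/V)/(1+γJ)` — and
`J_M → c_□Λ`, the route header's `D = γρ₀/(1 + c_□γΛ)`), into

* `stub_bornTrialState` (U, size L) — UPPER bound at the matched shift: `inf E_Δ ≤ e_ref + εργN`
  at small `ρ`, large `N`. The pure condensate gives only `γρ(N-1)/2 = e_ref(1+γJ_M)(1 - 1/N)`; a
  pair-correlated periodic trial state (band pair amplitudes `-D/(2(k²+Δ))`, momentum-space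
  Jastrow / number-projected Bogoliubov) realises the second-Born renormalisation; remainders
  `O(γρN√(ρa_B³)) + o_N(ργN) ≤ εργN`.
* `stub_penalisedLowerBound` (L, size XL, load-bearing) — LOWER bound WITH A CONDENSATE PENALTY
  below the fragmentation threshold: `∃ ϑ > 0 ∀ ε ∃ ρ₀ ∀ ρ < ρ₀ ∀ᶠ N ∀ Φ`,
  `E_Δ(Φ) + ϑργ·n₀(Φ) ≥ e_ref + ϑργ(1-ε)N`. Penalising the condensate by `λ = ϑργ` is lowering the
  shift on the excited modes to `Δ - λ`; the condensed HFB solution of `H_κ` (Bogoliubov matrix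
  `A_k = k² + κ - D`, `B_k = D`, `tanh 2t_k = D/(k² + κ - D)`, gap `√(κ(κ-2D))`) is stable iff
  `κ > 2D`, `D = γρ₀/(1+γJ)`, so any `ϑ < 2γJ/(1+γJ)` works (the fragmentation family
  `x ↦ κxρ + γρ²(1-2x)²/(2(1+γJ))` is convex with slope `ρ(κ - 2D₀) ≥ 0` at `x = 0`), and its depletion
  is `O(√(ρa_B³)) → 0`; the content is mean-field exactness of the band-limited all-to-all pairing at
  `T = 0`, fixed `N` (approximating Hamiltonian / c-number substitution; the crux's recorded
  why-might-fail — printed only grand-canonically, PuleZagrebnov2007 — sits exactly here).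
* PROVED here (no sorry): the base case `γ = 0` (free torus gas: `inf E = 0`,
  `periodicGroundStateEnergy_zero_eq_zero`, and the kinetic gap `N ≤ n₀ + (L/2π)²E`,
  `CouplingSelect.natCast_le_condensateOccupation_add_energy` / `CouplingSelect.anchor`), the
  definitional identification of the crux with `anchorE γ (2ργ)` (`RichardsonAnchorBEC_iff`, `Iff.rfl`),
  and the assembly `interacting_case`: U at `εϑ/3`, L at `ε/3`, `δ := (εϑ/3)ργN`; the chain
  `e_ref + λ(1-ε/3)N ≤ E_Δ(Ψ) + λn₀ ≤ inf E_Δ + δ + λn₀ ≤ e_ref + 2δ + λn₀` in `ℝ≥0∞` cancels `e_ref`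
  (finite) and `λ > 0`, leaving `(1-ε)N ≤ n₀` (~50 lines, axioms propext/Classical.choice/Quot.sound).
* `RichardsonAnchorBEC_of : Goal.stub_bornTrialState → Goal.stub_penalisedLowerBound → <crux BY NAME>`
  (the `Goal.stub_*` abbrevs are verbatim the stub statements, so the skeleton audit reads the
  hypotheses as the two declared stubs) and `RichardsonAnchorBEC_proof : <crux> :=
  RichardsonAnchorBEC_of stub_bornTrialState stub_penalisedLowerBound` (guard that the copies agree;
  its only non-whitelisted axiom is the stubs' `sorryAx`).

Hardest stub: `stub_penalisedLowerBound`. Why neither stub is the crux: U is an energy upper bound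
(no information on `n₀`); L bounds the PENALISED functional from below relative to `e_ref` and says
nothing about near-minimisers of `E_Δ` until an upper bound pins `inf E_Δ` to `e_ref` — and L is not
a consequence of the crux either (the crux carries no energy asymptotics). Barriers:
`EnergyAsymptoticsWithoutCondensation(Narrow)` — respected: condensation is read off the energy WITH
a number-conserving source (first order in `λ`), not off two-term source-free asymptotics;
`BogoliubovPerturbationInfrared` — does not bite the anchor (gapped at `κ = Δ > 2D`; it is rank 2's
barrier). Disproof used: none exists (`ledger crux ls stmt-AtomisticToContinuum-14805`: no workfiles
before this one; negatives index 2026-08-17: no Richardson/anchor entry). Dead lines: none recorded.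

BC3 probes (registrar folder `bc/probe_<stub>_to_{crux,summit}.lean`, route file + HarnessLib only,
defs verbatim, `first | exact? | simpa | aesop` under `maxHeartbeats 400000`): all four FAIL (rc 1,
`unsolved goals ⊢ RichardsonAnchorBEC` / `⊢ _root_.BoseEinsteinCondensation`, aesop exhaustive
search failed). `lean check --json` of this file: rc 0, errors [], sorries 2 = the 2 stubs, zero
elsewhere; `#h21_check_skeleton` dry run: ok, codes [].
-/

noncomputable section

namespace Summit.AtomisticToContinuum.BoseEinsteinCondensation.Cruxes.RichardsonAnchorBEC.Birth

open MeasureTheory Filter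
open scoped ENNReal NNReal
open Literature.MathematicalPhysics.QuantumManyBody.BoseGas
open Summit.AtomisticToContinuum.BoseEinsteinCondensation.Theses.BECRichardsonGaudin

/-! ## The anchor functional with a free shift, and the Born-renormalised reference energy -/

/-- **The anchor functional with shift `κ`** on the torus of side `L = L_N(ρ)`, `N = n + 2`, band
`M = ⌊ΛL/2π⌋`: `E_κ(Φ) = ∫|∇Φ|² + κ (N - n₀(Φ)) + (γ/L⁹)(N(N-1)/2) ∫_{cell^{N-2}} |∫∫ conj(w_M(x,y)) Φ(x,y,Y) dx dy|² dY`
— VERBATIM the `let`-chain of the crux `RichardsonAnchorBEC` with the shift coefficient `2ργ`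
replaced by a free `κ`; the crux's functional is `anchorE γ (2 * ρ * γ) ρ n Λ` (definitionally:
`RichardsonAnchorBEC_iff`). Second-quantised: `⟨Φ, H_κ Φ⟩`, `H_κ = ∑_k k² n_k + κ ∑_{k ≠ 0} n_k +
(γ/2V) P†_M P_M`, `P_M = ∑_{k ∈ B_M} a_{-k} a_k` (zero mode included). [folklore] -/
def anchorE (γ κ ρ : ℝ) (n : ℕ) (Λ : ℝ) :
    PeriodicTrialState (n + 2) (sideLength ρ (n + 2)) → ℝ≥0∞ :=
  let N : ℕ := n + 2
  let L : ℝ := Literature.MathematicalPhysics.QuantumManyBody.BoseGas.sideLength ρ N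
  let M : ℕ := ⌊Λ * L / (2 * Real.pi)⌋₊
  let w : EuclideanSpace ℝ (Fin 3) → EuclideanSpace ℝ (Fin 3) → ℂ := fun x y =>
    ∑ m ∈ Fintype.piFinset (fun _ : Fin 3 => Finset.Icc (-(M : ℤ)) M),
      Complex.exp (2 * Real.pi * Complex.I / L * ∑ j : Fin 3, (m j : ℂ) * ((x j - y j : ℝ) : ℂ))
  fun Φ => Literature.MathematicalPhysics.QuantumManyBody.BoseGas.periodicEnergy 0 Φ +
    ENNReal.ofReal κ * ((N : ENNReal) -
      Literature.MathematicalPhysics.QuantumManyBody.BoseGas.condensateOccupation N L Φ.ψ) +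
    ENNReal.ofReal (γ / L ^ 9 * ((N : ℝ) * (N - 1) / 2)) *
      ∫⁻ Y in Literature.MathematicalPhysics.QuantumManyBody.BoseGas.cellN n L,
        (‖∫ x in Literature.MathematicalPhysics.QuantumManyBody.BoseGas.cell L,
            ∫ y in Literature.MathematicalPhysics.QuantumManyBody.BoseGas.cell L,
              (starRingEnd ℂ) (w x y) * Φ.ψ (Matrix.vecCons x (Matrix.vecCons y Y))‖₊ : ENNReal) ^ 2

/-- **Zero-energy pair bubble of the band** `J_M(L) = (1/(2L³)) ∑_{m ∈ B_M, m ≠ 0} 1/k_m²`,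
`k_m = 2π|m|/L`, `B_M = {-M,…,M}³` (ordered sum over the band's non-zero modes; `→ c_□ Λ`,
`c_□ = (16π³)⁻¹ ∫_{[-1,1]³} du/|u|²`, as `L → ∞` with `M = ⌊ΛL/2π⌋`). The band-limited zero-momentum
pair `T`-matrix of the anchor is the geometric (Born) series `γ/(1 + γ J_M)`. [folklore] -/
def bandBubble (L : ℝ) (M : ℕ) : ℝ :=
  1 / (2 * L ^ 3) * ∑ m ∈ (Fintype.piFinset (fun _ : Fin 3 => Finset.Icc (-(M : ℤ)) M)).erase 0,
    1 / ((2 * Real.pi / L) ^ 2 * ∑ j : Fin 3, ((m j : ℤ) : ℝ) ^ 2)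

/-- **Born-renormalised Hartree energy** of the anchor at density `ρ`, `N = n + 2`, `L = L_N(ρ)`,
`M = ⌊ΛL/2π⌋`: `e_ref = γ ρ N / (2 (1 + γ J_M(L)))` — the Hartree energy `γρN/2` of the pure
condensate divided by the pair-bubble resummation (for `N = 2` this is the exact lowest pair
energy of `(γ/2V)P†P` to leading order; for the dilute anchor it is `e₀ N (1 + O(√(ρ a_B³)))`). [folklore] -/
def bornEnergy (γ ρ : ℝ) (n : ℕ) (Λ : ℝ) : ℝ :=
  γ * ρ * ((n + 2 : ℕ) : ℝ) /
    (2 * (1 + γ * bandBubble (sideLength ρ (n + 2)) ⌊Λ * sideLength ρ (n + 2) / (2 * Real.pi)⌋₊))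

/-! ## Registered stubs -/

/-- **stub U — Born-renormalised trial state (upper bound at the matched shift `Δ = 2ργ`).**
For `γ > 0`, `Λ > 0`, `ε > 0`, at all small `ρ` and all large `N`: `inf_Φ E_Δ(Φ) ≤ e_ref + ε ργ N`.
The pure condensate only gives `γρ(N-1)/2 = e_ref (1 + γJ_M)`: the stub asks for a pair-correlated
(momentum-space Jastrow / number-projected Bogoliubov) periodic trial state whose band pair amplitudes
`-D/(2(k²+Δ))` realise the second-Born renormalisation `γ → γ/(1+γJ_M)`, with the LHY-type and
finite-size remainders `O(γρN √(ρ a_B³)) + o_N(ργN)` absorbed in `ε ργ N`. Size L. -/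
theorem stub_bornTrialState :
    ∀ γ Λ ε : ℝ, 0 < γ → 0 < Λ → 0 < ε → ∃ ρ₀ : ℝ, 0 < ρ₀ ∧ ∀ ρ : ℝ, 0 < ρ → ρ < ρ₀ →
      ∀ᶠ n : ℕ in Filter.atTop,
        (⨅ Φ, anchorE γ (2 * ρ * γ) ρ n Λ Φ) ≤
          ENNReal.ofReal (bornEnergy γ ρ n Λ) + ENNReal.ofReal (ε * (ρ * γ) * ((n + 2 : ℕ) : ℝ)) := by
  sorry

/-- **stub L — condensate-penalised mean-field lower bound below the fragmentation threshold.**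
For `γ > 0`, `Λ > 0` there is `ϑ > 0` (any `ϑ < 2γJ/(1+γJ) = (Δ - 2D)/(ργ)`, `D = γρ/(1+γJ)` the
renormalised pairing field) such that for every `ε > 0`, at all small `ρ` and all large `N`, EVERY
periodic state `Φ` satisfies `E_Δ(Φ) + ϑργ · n₀(Φ) ≥ e_ref + ϑργ (1 - ε) N`: penalising the
condensate by `λ = ϑργ` per particle raises the anchor's ground-state energy by the full `λN` up to
`ελN` — the condensate of the Richardson anchor is rigid (no fragmentation into the soft pair modes,
depletion `O(√(ρa_B³))`). Mean-field exactness of the band-limited all-to-all pairing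
(approximating-Hamiltonian / c-number substitution, `P†P ≥ c̄P + cP† - |c|²`) plus stability of the
condensed HFB solution at shift `Δ - λ > 2D`. Size XL (the heart of the crux). -/
theorem stub_penalisedLowerBound :
    ∀ γ Λ : ℝ, 0 < γ → 0 < Λ → ∃ ϑ : ℝ, 0 < ϑ ∧ ∀ ε : ℝ, 0 < ε → ∃ ρ₀ : ℝ, 0 < ρ₀ ∧
      ∀ ρ : ℝ, 0 < ρ → ρ < ρ₀ → ∀ᶠ n : ℕ in Filter.atTop,
        ∀ Φ : PeriodicTrialState (n + 2) (sideLength ρ (n + 2)),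
          ENNReal.ofReal (bornEnergy γ ρ n Λ + ϑ * (ρ * γ) * (1 - ε) * ((n + 2 : ℕ) : ℝ)) ≤
            anchorE γ (2 * ρ * γ) ρ n Λ Φ +
              ENNReal.ofReal (ϑ * (ρ * γ)) * condensateOccupation (n + 2) (sideLength ρ (n + 2)) Φ.ψ := by
  sorry

/-! ### Audit names of the stub statements

`Goal.stub_x : Prop` is VERBATIM the statement of the registered stub `stub_x` above, so that the
skeleton audit (`#h21_check_skeleton`, by-name policy on hypothesis heads) reads the hypotheses of
`RichardsonAnchorBEC_of` as exactly the two declared stubs; `RichardsonAnchorBEC_proof` below is the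
kernel-checked guard that the two copies agree. -/

namespace Goal

/-- Statement of stub U `stub_bornTrialState`. -/
abbrev stub_bornTrialState : Prop :=
    ∀ γ Λ ε : ℝ, 0 < γ → 0 < Λ → 0 < ε → ∃ ρ₀ : ℝ, 0 < ρ₀ ∧ ∀ ρ : ℝ, 0 < ρ → ρ < ρ₀ →
      ∀ᶠ n : ℕ in Filter.atTop,
        (⨅ Φ, anchorE γ (2 * ρ * γ) ρ n Λ Φ) ≤
          ENNReal.ofReal (bornEnergy γ ρ n Λ) + ENNReal.ofReal (ε * (ρ * γ) * ((n + 2 : ℕ) : ℝ))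

/-- Statement of stub L `stub_penalisedLowerBound`. -/
abbrev stub_penalisedLowerBound : Prop :=
    ∀ γ Λ : ℝ, 0 < γ → 0 < Λ → ∃ ϑ : ℝ, 0 < ϑ ∧ ∀ ε : ℝ, 0 < ε → ∃ ρ₀ : ℝ, 0 < ρ₀ ∧
      ∀ ρ : ℝ, 0 < ρ → ρ < ρ₀ → ∀ᶠ n : ℕ in Filter.atTop,
        ∀ Φ : PeriodicTrialState (n + 2) (sideLength ρ (n + 2)),
          ENNReal.ofReal (bornEnergy γ ρ n Λ + ϑ * (ρ * γ) * (1 - ε) * ((n + 2 : ℕ) : ℝ)) ≤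
            anchorE γ (2 * ρ * γ) ρ n Λ Φ +
              ENNReal.ofReal (ϑ * (ρ * γ)) * condensateOccupation (n + 2) (sideLength ρ (n + 2)) Φ.ψ

end Goal

/-! ## Proved glue (no `sorry` below this line) -/

/-- The crux is, definitionally, the statement about `anchorE γ (2ργ) ρ n Λ`. [folklore] -/
theorem RichardsonAnchorBEC_iff :
    RichardsonAnchorBEC ↔
      ∀ γ Λ ε : ℝ, 0 ≤ γ → 0 < Λ → 0 < ε → ∃ ρ₀ : ℝ, 0 < ρ₀ ∧ ∀ ρ : ℝ, 0 < ρ → ρ < ρ₀ →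
        ∀ᶠ n : ℕ in Filter.atTop, ∃ δ : ℝ≥0∞, 0 < δ ∧
          ∀ Ψ : PeriodicTrialState (n + 2) (sideLength ρ (n + 2)),
            anchorE γ (2 * ρ * γ) ρ n Λ Ψ ≤ (⨅ Φ, anchorE γ (2 * ρ * γ) ρ n Λ Φ) + δ →
              ENNReal.ofReal ((1 - ε) * ((n + 2 : ℕ) : ℝ)) ≤
                condensateOccupation (n + 2) (sideLength ρ (n + 2)) Ψ.ψ :=
  Iff.rfl

/-- `L_N(ρ) > 0` for `ρ > 0`, `N = n + 2`. [folklore] -/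
theorem sideLength_succ_succ_pos {ρ : ℝ} (hρ : 0 < ρ) (n : ℕ) : 0 < sideLength ρ (n + 2) :=
  Real.rpow_pos_of_pos (div_pos (by positivity) hρ) _

/-- `J_M(L) ≥ 0` for `L ≥ 0`. [folklore] -/
theorem bandBubble_nonneg {L : ℝ} (hL : 0 ≤ L) (M : ℕ) : 0 ≤ bandBubble L M := by
  unfold bandBubble
  exact mul_nonneg (by positivity) (Finset.sum_nonneg fun m _ => by positivity)

/-- `e_ref ≥ 0` for `γ ≥ 0`, `ρ > 0`. [folklore] -/
theorem bornEnergy_nonneg {γ ρ : ℝ} (hγ : 0 ≤ γ) (hρ : 0 < ρ) (n : ℕ) (Λ : ℝ) :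
    0 ≤ bornEnergy γ ρ n Λ := by
  unfold bornEnergy
  have hJ := bandBubble_nonneg (sideLength_succ_succ_pos hρ n).le
    ⌊Λ * sideLength ρ (n + 2) / (2 * Real.pi)⌋₊
  positivity

/-- At `γ = 0` the anchor functional is the free kinetic energy. [folklore] -/
theorem anchorE_zero (ρ : ℝ) (n : ℕ) (Λ : ℝ) (Φ : PeriodicTrialState (n + 2) (sideLength ρ (n + 2))) :
    anchorE 0 (2 * ρ * 0) ρ n Λ Φ = periodicEnergy 0 Φ := by
  simp [anchorE]

/-- **Base case `γ = 0` (the free torus gas), PROVED from the tree**: `inf E = E₀^per(0) = 0`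
(`periodicGroundStateEnergy_zero_eq_zero`) and the kinetic gap `N ≤ n₀(Ψ) + (L/2π)² E(Ψ)`
(`CouplingSelect.natCast_le_condensateOccupation_add_energy`, packaged as `CouplingSelect.anchor`):
with `δ = 4π²εN/L²` every `δ`-near-minimiser has `n₀ ≥ (1-ε)N`. [folklore] -/
theorem free_case (Λ ε : ℝ) (hε : 0 < ε) :
    ∃ ρ₀ : ℝ, 0 < ρ₀ ∧ ∀ ρ : ℝ, 0 < ρ → ρ < ρ₀ → ∀ᶠ n : ℕ in Filter.atTop, ∃ δ : ℝ≥0∞, 0 < δ ∧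
      ∀ Ψ : PeriodicTrialState (n + 2) (sideLength ρ (n + 2)),
        anchorE 0 (2 * ρ * 0) ρ n Λ Ψ ≤ (⨅ Φ, anchorE 0 (2 * ρ * 0) ρ n Λ Φ) + δ →
          ENNReal.ofReal ((1 - ε) * ((n + 2 : ℕ) : ℝ)) ≤
            condensateOccupation (n + 2) (sideLength ρ (n + 2)) Ψ.ψ := by
  refine ⟨1, one_pos, fun ρ hρ _ => Filter.Eventually.of_forall fun n => ?_⟩
  have hL : 0 < sideLength ρ (n + 2) := sideLength_succ_succ_pos hρ n
  obtain ⟨δ, hδ, h⟩ :=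
    Summit.AtomisticToContinuum.BoseEinsteinCondensation.Cruxes.PeriodicIRBound.FsumPhasePencil.CouplingSelect.anchor
      (N := n + 2) (L := sideLength ρ (n + 2)) (by omega) hL (b := 1 - ε) (by linarith)
      (0 : ℝ → ℝ≥0∞) rfl
  refine ⟨δ, hδ, fun Ψ hΨ => ENNReal.ofReal_le_of_le_toReal (h Ψ ?_)⟩
  have hinf : (⨅ Φ, anchorE 0 (2 * ρ * 0) ρ n Λ Φ) =
      periodicGroundStateEnergy 0 (n + 2) (sideLength ρ (n + 2)) := by
    simp only [anchorE_zero]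
    rfl
  rw [← hinf, ← anchorE_zero ρ n Λ Ψ]
  exact hΨ

/-- **Interacting case `γ > 0` from the two stub STATEMENTS** (the variational / Hellmann–Feynman
inequality at fixed `N`, all in `ℝ≥0∞`): stub L at `(ε/3)` gives `ϑ` and, for every state,
`e_ref + λ(1-ε/3)N ≤ E_Δ(Ψ) + λ n₀(Ψ)` with `λ = ϑργ`; stub U at `εϑ/3` gives
`inf E_Δ ≤ e_ref + (εϑ/3)ργN`; for a `δ`-near-minimiser with `δ := (εϑ/3)ργN` the chain
`e_ref + λ(1-ε/3)N ≤ inf E_Δ + δ + λn₀ ≤ e_ref + 2δ + λn₀` cancels `e_ref` (finite) and leaves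
`λ(1-ε)N ≤ λ n₀`, i.e. `(1-ε)N ≤ n₀`. [folklore] -/
theorem interacting_case {γ Λ ε : ℝ} (hγ : 0 < γ) (hΛ : 0 < Λ) (hε : 0 < ε)
    (hU : Goal.stub_bornTrialState) (hL : Goal.stub_penalisedLowerBound) :
    ∃ ρ₀ : ℝ, 0 < ρ₀ ∧ ∀ ρ : ℝ, 0 < ρ → ρ < ρ₀ → ∀ᶠ n : ℕ in Filter.atTop, ∃ δ : ℝ≥0∞, 0 < δ ∧
      ∀ Ψ : PeriodicTrialState (n + 2) (sideLength ρ (n + 2)),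
        anchorE γ (2 * ρ * γ) ρ n Λ Ψ ≤ (⨅ Φ, anchorE γ (2 * ρ * γ) ρ n Λ Φ) + δ →
          ENNReal.ofReal ((1 - ε) * ((n + 2 : ℕ) : ℝ)) ≤
            condensateOccupation (n + 2) (sideLength ρ (n + 2)) Ψ.ψ := by
  -- `ε ≥ 1`: the conclusion is `0 ≤ n₀`
  rcases le_or_gt 1 ε with hε1 | hε1
  · refine ⟨1, one_pos, fun ρ hρ _ => Filter.Eventually.of_forall fun n => ⟨1, one_pos, fun Ψ _ => ?_⟩⟩
    rw [ENNReal.ofReal_of_nonpos (mul_nonpos_of_nonpos_of_nonneg (by linarith) (by positivity))]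
    exact bot_le
  -- `0 < ε < 1`
  obtain ⟨ϑ, hϑ, hL1⟩ := hL γ Λ hγ hΛ
  obtain ⟨ρ₁, hρ₁, h₁⟩ := hL1 (ε / 3) (by positivity)
  obtain ⟨ρ₂, hρ₂, h₂⟩ := hU γ Λ (ε * ϑ / 3) hγ hΛ (by positivity)
  refine ⟨min ρ₁ ρ₂, lt_min hρ₁ hρ₂, fun ρ hρ hρlt => ?_⟩
  filter_upwards [h₁ ρ hρ (hρlt.trans_le (min_le_left _ _)),
    h₂ ρ hρ (hρlt.trans_le (min_le_right _ _))] with n hLn hUn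
  set N : ℕ := n + 2 with hN
  set lam : ℝ := ϑ * (ρ * γ) with hlam
  set b : ℝ := bornEnergy γ ρ n Λ with hb
  set η : ℝ := ε * ϑ / 3 * (ρ * γ) * (N : ℝ) with hη
  have hlam0 : 0 < lam := by positivity
  have hNpos : (0 : ℝ) < N := by positivity
  have hb0 : 0 ≤ b := bornEnergy_nonneg hγ.le hρ n Λ
  have hη0 : 0 < η := by positivity
  have hA0 : 0 ≤ lam * (1 - ε / 3) * N := by
    have : 0 < 1 - ε / 3 := by linarith
    positivity
  refine ⟨ENNReal.ofReal η, ENNReal.ofReal_pos.2 hη0, fun Ψ hΨ => ?_⟩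
  set n₀ : ℝ≥0∞ := condensateOccupation N (sideLength ρ N) Ψ.ψ with hn₀
  have hLΨ := hLn Ψ
  have key : ENNReal.ofReal b + ENNReal.ofReal (lam * (1 - ε / 3) * N) ≤
      ENNReal.ofReal b + (ENNReal.ofReal η + ENNReal.ofReal η + ENNReal.ofReal lam * n₀) := by
    calc ENNReal.ofReal b + ENNReal.ofReal (lam * (1 - ε / 3) * N)
        = ENNReal.ofReal (b + lam * (1 - ε / 3) * N) := (ENNReal.ofReal_add hb0 hA0).symm
      _ ≤ anchorE γ (2 * ρ * γ) ρ n Λ Ψ + ENNReal.ofReal lam * n₀ := hLΨ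
      _ ≤ (⨅ Φ, anchorE γ (2 * ρ * γ) ρ n Λ Φ) + ENNReal.ofReal η + ENNReal.ofReal lam * n₀ :=
          add_le_add hΨ le_rfl
      _ ≤ ENNReal.ofReal b + ENNReal.ofReal η + ENNReal.ofReal η + ENNReal.ofReal lam * n₀ :=
          add_le_add (add_le_add hUn le_rfl) le_rfl
      _ = ENNReal.ofReal b + (ENNReal.ofReal η + ENNReal.ofReal η + ENNReal.ofReal lam * n₀) := by
          simp only [add_assoc]
  have key2 : ENNReal.ofReal (lam * (1 - ε / 3) * N) ≤
      ENNReal.ofReal η + ENNReal.ofReal η + ENNReal.ofReal lam * n₀ :=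
    (ENNReal.add_le_add_iff_left ENNReal.ofReal_ne_top).1 key
  have key3 : ENNReal.ofReal (lam * (1 - ε / 3) * N - (η + η)) ≤ ENNReal.ofReal lam * n₀ := by
    rw [ENNReal.ofReal_sub _ (by positivity), ENNReal.ofReal_add hη0.le hη0.le]
    exact tsub_le_iff_right.2 (key2.trans_eq (add_comm _ _))
  have hring : lam * (1 - ε / 3) * N - (η + η) = lam * ((1 - ε) * N) := by
    simp only [hlam, hη]
    ring
  rw [hring, ENNReal.ofReal_mul hlam0.le] at key3
  exact (ENNReal.mul_le_mul_iff_right (ENNReal.ofReal_pos.2 hlam0).ne' ENNReal.ofReal_ne_top).1 key3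

/-- **THE SKELETON THEOREM — the crux BY NAME from the two stub statements** (hypotheses by their
audit names `Goal.stub_*`, verbatim the statements of `stub_bornTrialState` and
`stub_penalisedLowerBound`): split `γ = 0` (proved, `free_case`) / `γ > 0` (`interacting_case`).
[folklore] -/
theorem RichardsonAnchorBEC_of :
    Goal.stub_bornTrialState → Goal.stub_penalisedLowerBound →
      Summit.AtomisticToContinuum.BoseEinsteinCondensation.Theses.BECRichardsonGaudin.RichardsonAnchorBEC := by
  intro hU hL
  rw [RichardsonAnchorBEC_iff]
  intro γ Λ ε hγ hΛ hε
  rcases hγ.eq_or_lt with h | hγ'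
  · subst h
    exact free_case Λ ε hε
  · exact interacting_case hγ' hΛ hε hU hL

/-- The skeleton as a (sorried-through-the-stubs) proof of the crux: `RichardsonAnchorBEC_of`
applied to the two registered `stub_*` theorems — also the guard that their types are VERBATIM the
`Goal.stub_*` statements. Its only non-whitelisted axiom is the `sorryAx` of the two stubs. [folklore] -/
theorem RichardsonAnchorBEC_proof :
    Summit.AtomisticToContinuum.BoseEinsteinCondensation.Theses.BECRichardsonGaudin.RichardsonAnchorBEC :=
  RichardsonAnchorBEC_of stub_bornTrialState stub_penalisedLowerBound

end Summit.AtomisticToContinuum.BoseEinsteinCondensation.Cruxes.RichardsonAnchorBEC.Birth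

end
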